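import Literature.Computability.Complexity.ShenOperators
import HarnessLib

/-!
# The polynomials of the `IP = PSPACE` protocol: the expression `∀_{X₁}L₁ ∃_{X₂}L₁L₂ ⋯ Qₙ L₁⋯Lₙ P`
# (Arora–Barak §8.3.3), its degree invariant and its Boolean semantics

Consumer of `ShenOperators.lean`. For a quantifier pattern `Q` (`true = ∀`) on the variables listed
outermost-first and a matrix polynomial `P`, this file builds the polynomial of Arora–Barak's expression
("we use the expression `∀_{X₁}L₁∃_{X₂}L₁L₂∀_{X₃}L₁L₂L₃⋯∃_{Xₙ}L₁L₂L₃⋯LₙP_φ(X₁,…,Xₙ)`", p. 194) by structural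
recursion on the list of variables still to be quantified — `Shen.shenExpr Q pre (v :: rest) P =
Q_v (L_{pre₁} ⋯ L_{pre_k} L_v (shenExpr Q (pre ++ [v]) rest P))`, `shenExpr Q pre [] P = P` — which is
the family `f_{n,i}` of Trevisan–Vadhan's Lemma 4.1 up to flattening the two-level index, and proves:

* `Shen.linChain` (a chain of linearizations), `linChain_cons`; `degreeOf_linChain_le` (after the chain
  every listed variable has degree `≤ 1`, the others are untouched), `degreeOf_linChain_le_max`
  (INTERMEDIATE degrees never exceed `max (deg) 1`), `eval_linChain_boolPt` (no change at Boolean points);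
* **the degree invariant** `degreeOf_shenExpr_le`: if `pre, rest` cover all variables and `rest ≠ []`, the
  block output has degree `0` in the variables of `rest` (eliminated) and `≤ 2` in all others —
  independently of `P` (the innermost chain linearizes everything first); with
  `totalDegree_le_sum_degreeOf` this is Trevisan–Vadhan's (iii) "total degree at most `poly(n)`"
  (`totalDegree_shenExpr_le`: `≤ 2|σ|`);
* **the Boolean semantics** `eval_shenExpr_boolPt`: at every Boolean point the block output evaluates to
  the truth value `Shen.qbfVal Q rest φ` of the quantified suffix over the matrix `φ` (given that `P`
  arithmetizes `φ`: `P(x) = [φ x]` on Boolean `x`) — Arora–Barak's "(8.12) may be rephrased … we get a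
  nonzero value" in the Boolean-valued form of Shamir / Trevisan–Vadhan ("`f_{n,0}` … equals the truth
  value of `Φₙ`");
* **downward self-reduction** is the defining equations read with `ShenOperators.eval_*`: every
  polynomial of the family is ONE operator applied to the next one (`shenExpr_cons`, `linChain_cons`), and
  the value of an operator's output at a point is an explicit function of two values of its input
  (`Shen.eval_linOp/allOp/exOp`) — Trevisan–Vadhan's (i).

Everything is proved; the definitions are `linChain`, `qop`, `shenExpr`, `boolPt`, `qbfVal`. The variable
set `σ` is arbitrary (decidable equality; finite for the total-degree bound), so that free variables that
are never quantified — Trevisan–Vadhan's `y, z` of the universal formula — are simply listed in `pre`.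

## References

* [AroraBarakCC2009] S. Arora, B. Barak, CUP 2009, §8.3.3, p. 194 (the expression and "The size of the
  expression is `O(n²)`"), Thm. 8.19.
* [TrevisanVadhan2007] L. Trevisan, S. Vadhan, Comput. Complexity 16 (2007), §4, Lemma 4.1 (i)–(iii) and its
  proof sketch ("Each `fᵢ` has variables `(x₁,…,x_ℓ)` … defined in terms of `f_{i+1}` using one of the
  following rules").
-/

noncomputable section

namespace Literature.Computability.Complexity

namespace Shen

open MvPolynomial Finset

variable {R : Type*} [CommRing R] {σ : Type*} [DecidableEq σ]

/-! ### Chains of linearizations -/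

/-- `L_{v₁} (L_{v₂} (⋯ (L_{v_k} q)))` — the last listed variable is linearized first.
[cite: AroraBarakCC2009, §8.3.3 ("`L₁L₂⋯Lₖ`")] -/
def linChain (vars : List σ) (q : MvPolynomial σ R) : MvPolynomial σ R :=
  vars.foldr (fun u r => linOp u r) q

/-- Unfolding a chain. [folklore] -/
@[simp] theorem linChain_nil (q : MvPolynomial σ R) : linChain [] q = q := rfl

/-- Unfolding a chain: the head is applied last. [folklore] -/
@[simp] theorem linChain_cons (u : σ) (vars : List σ) (q : MvPolynomial σ R) :
    linChain (u :: vars) q = linOp u (linChain vars q) := rfl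

section Deg

variable [Nontrivial R]

/-- **After a chain, every listed variable has degree `≤ 1` and no other degree went up.** [cite: AroraBarakCC2009, §8.3.3] -/
theorem degreeOf_linChain_le (k : σ) (vars : List σ) (q : MvPolynomial σ R) :
    degreeOf k (linChain vars q) ≤ if k ∈ vars then 1 else degreeOf k q := by
  induction vars with
  | nil => simp
  | cons u vars ih =>
    rw [linChain_cons]
    by_cases hku : k = u
    · subst hku
      simpa using degreeOf_linOp_self_le k (linChain vars q)
    · refine (degreeOf_linOp_le hku _).trans (ih.trans ?_)
      simp only [List.mem_cons, hku, false_or]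
      exact le_rfl

/-- Intermediate degrees along a chain never exceed `max (deg_k q) 1`. [folklore] -/
theorem degreeOf_linChain_le_max (k : σ) (vars : List σ) (q : MvPolynomial σ R) :
    degreeOf k (linChain vars q) ≤ max (degreeOf k q) 1 := by
  refine (degreeOf_linChain_le k vars q).trans ?_
  split_ifs
  · exact le_max_right _ _
  · exact le_max_left _ _

end Deg

/-! ### The expression of the protocol -/

/-- The quantifier operator of variable `v`: `∀_v` if `Q v`, else `∃_v`. [cite: AroraBarakCC2009, §8.3.3 (8.14)–(8.15)] -/
def qop (Q : σ → Bool) (v : σ) (q : MvPolynomial σ R) : MvPolynomial σ R :=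
  if Q v then allOp v q else exOp v q

/-- **The protocol's polynomial**, by recursion on the variables still to quantify (outermost first), with
`pre` the variables already passed: `Q_v L_{pre} L_v (⋯)` and the matrix at the end.
[cite: AroraBarakCC2009, §8.3.3 (the expression, p. 194)] [cite: TrevisanVadhan2007, §4 (Lemma 4.1, proof sketch)] -/
def shenExpr (Q : σ → Bool) : List σ → List σ → MvPolynomial σ R → MvPolynomial σ R
  | _, [], P => P
  | pre, v :: rest, P => qop Q v (linChain (pre ++ [v]) (shenExpr Q (pre ++ [v]) rest P))

/-- The innermost level is the matrix. [folklore] -/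
@[simp] theorem shenExpr_nil (Q : σ → Bool) (pre : List σ) (P : MvPolynomial σ R) :
    shenExpr Q pre [] P = P := rfl

/-- **Downward self-reduction, structurally**: one quantifier operator on top of a chain of linearizations
of the next level. [cite: TrevisanVadhan2007, §4 (Lemma 4.1 (i))] -/
theorem shenExpr_cons (Q : σ → Bool) (pre : List σ) (v : σ) (rest : List σ)
    (P : MvPolynomial σ R) :
    shenExpr Q pre (v :: rest) P = qop Q v (linChain (pre ++ [v]) (shenExpr Q (pre ++ [v]) rest P)) := rfl

section Deg

variable [Nontrivial R]

/-- The quantifier operator kills its variable and at most doubles the other degrees. [folklore] -/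
theorem degreeOf_qop_le (Q : σ → Bool) (k v : σ) (q : MvPolynomial σ R) :
    degreeOf k (qop Q v q) ≤ if k = v then 0 else 2 * degreeOf k q := by
  unfold qop
  split_ifs with hQ hk hk
  · subst hk; rw [degreeOf_allOp_self]
  · exact degreeOf_allOp_le _ _ _
  · subst hk; rw [degreeOf_exOp_self]
  · exact degreeOf_exOp_le _ _ _

/-- **The degree invariant.** If `pre ++ rest` lists every variable without repetition and `rest ≠ []`,
the polynomial `shenExpr Q pre rest P` has degree `0` in the variables of `rest` and `≤ 2` in all others —
whatever the degrees of `P`. [cite: AroraBarakCC2009, §8.3.3 ("the intermediate polynomials … all have low degree")]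
[cite: TrevisanVadhan2007, §4 (Lemma 4.1 (iii))] -/
theorem degreeOf_shenExpr_le (Q : σ → Bool) (P : MvPolynomial σ R) :
    ∀ (rest pre : List σ), rest ≠ [] → (pre ++ rest).Nodup → (∀ u : σ, u ∈ pre ∨ u ∈ rest) →
      ∀ k : σ, degreeOf k (shenExpr Q pre rest P) ≤ if k ∈ rest then 0 else 2
  | [], _, h, _, _, _ => absurd rfl h
  | v :: rest, pre, _, hnd, hcov, k => by
    rw [shenExpr_cons]
    have hnd' : ((pre ++ [v]) ++ rest).Nodup := by rwa [List.append_assoc, List.singleton_append]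
    have hcov' : ∀ u : σ, u ∈ pre ++ [v] ∨ u ∈ rest := fun u => by
      rcases hcov u with h | h
      · exact Or.inl (List.mem_append_left _ h)
      · rcases List.mem_cons.1 h with rfl | h
        · exact Or.inl (List.mem_append_right _ (List.mem_singleton_self _))
        · exact Or.inr h
    -- degrees of the inner level in the variables still to come: `0`
    have hq : ∀ u : σ, u ∈ rest → degreeOf u (shenExpr Q (pre ++ [v]) rest P) = 0 := by
      intro u hu
      have hne : rest ≠ [] := List.ne_nil_of_mem hu
      have := degreeOf_shenExpr_le Q P rest (pre ++ [v]) hne hnd' hcov' u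
      rw [if_pos hu] at this
      exact Nat.le_zero.1 this
    -- membership bookkeeping from `Nodup`
    have hdisj : ∀ u : σ, u ∈ rest → u ∉ pre ++ [v] := fun u hu hu' =>
      (List.nodup_append.1 hnd').2.2 u hu' u hu rfl
    refine (degreeOf_qop_le Q k v _).trans ?_
    by_cases hkv : k = v
    · subst hkv; simp
    · rw [if_neg hkv]
      have hchain := degreeOf_linChain_le k (pre ++ [v]) (shenExpr Q (pre ++ [v]) rest P)
      by_cases hkr : k ∈ rest
      · -- eliminated later: untouched by the chain, degree `0` inside
        rw [if_pos (List.mem_cons_of_mem v hkr), if_neg (hdisj k hkr), hq k hkr] at *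
        omega
      · -- a passed variable: linearized by the chain
        have hkp : k ∈ pre ++ [v] := by
          rcases hcov' k with h | h
          · exact h
          · exact absurd h hkr
        rw [if_pos hkp] at hchain
        rw [if_neg (by simp [hkv, hkr])]
        omega

omit [Nontrivial R] [DecidableEq σ] in
/-- The total degree is at most the sum of the degrees in the single variables. [folklore] -/
theorem totalDegree_le_sum_degreeOf [Fintype σ] (p : MvPolynomial σ R) : p.totalDegree ≤ ∑ k : σ, degreeOf k p := by
  classical
  rw [totalDegree]
  refine Finset.sup_le fun m hm => ?_
  calc (m.sum fun _ e => e) = ∑ k ∈ m.support, m k := rfl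
    _ ≤ ∑ k : σ, m k := Finset.sum_le_sum_of_subset (Finset.subset_univ _)
    _ ≤ ∑ k : σ, degreeOf k p := Finset.sum_le_sum fun k _ => monomial_le_degreeOf k hm

/-- **Low total degree** of the protocol's polynomials (block outputs): `≤ 2n`.
[cite: TrevisanVadhan2007, §4 (Lemma 4.1 (iii): "total degree at most `poly(n)`")] -/
theorem totalDegree_shenExpr_le [Fintype σ] (Q : σ → Bool) (P : MvPolynomial σ R) {rest pre : List σ}
    (hne : rest ≠ []) (hnd : (pre ++ rest).Nodup) (hcov : ∀ u : σ, u ∈ pre ∨ u ∈ rest) :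
    (shenExpr Q pre rest P).totalDegree ≤ 2 * Fintype.card σ := by
  refine (totalDegree_le_sum_degreeOf _).trans ?_
  calc ∑ k : σ, degreeOf k (shenExpr Q pre rest P) ≤ ∑ _k : σ, 2 :=
        Finset.sum_le_sum fun k _ => (degreeOf_shenExpr_le Q P rest pre hne hnd hcov k).trans (by split_ifs <;> omega)
    _ = 2 * Fintype.card σ := by simp [mul_comm]

end Deg

/-! ### Boolean semantics -/

/-- The `0/1` point of a Boolean assignment. [folklore] -/
def boolPt (x : σ → Bool) : σ → R := fun u => boolVal (x u)

/-- Updating commutes with the `0/1` embedding. [folklore] -/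
theorem boolPt_update (x : σ → Bool) (v : σ) (b : Bool) :
    (boolPt (Function.update x v b) : σ → R) = Function.update (boolPt x) v (boolVal b) := by
  funext u
  by_cases h : u = v
  · subst h; simp [boolPt]
  · simp [boolPt, Function.update_of_ne h]

/-- **A chain of linearizations changes nothing at a Boolean point.** [cite: AroraBarakCC2009, §8.3.3] -/
theorem eval_linChain_boolPt (x : σ → Bool) (vars : List σ) (q : MvPolynomial σ R) :
    eval (boolPt x) (linChain vars q) = eval (boolPt x) q := by
  induction vars with
  | nil => rfl
  | cons u vars ih =>
    rw [linChain_cons, eval_linOp_of_boolean _ _ _ (by unfold boolPt boolVal; cases x u <;> simp), ih]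

/-- **The truth value of a quantified suffix** `Q_{v₁} x_{v₁} ⋯ Q_{v_k} x_{v_k} . φ(x)` (variables of `rest`
quantified, `∀` where `Q`, the others read off `x`). [cite: AroraBarakCC2009, §8.3.3 (8.12)] -/
def qbfVal (Q : σ → Bool) : List σ → ((σ → Bool) → Bool) → (σ → Bool) → Bool
  | [], φ, x => φ x
  | v :: rest, φ, x =>
      if Q v then qbfVal Q rest φ (Function.update x v false) && qbfVal Q rest φ (Function.update x v true)
      else qbfVal Q rest φ (Function.update x v false) || qbfVal Q rest φ (Function.update x v true)

/-- The quantifier operator on Boolean values. [folklore] -/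
theorem eval_qop_boolean (Q : σ → Bool) (v : σ) (q : MvPolynomial σ R) (y : σ → R) {b₀ b₁ : Bool}
    (h₀ : eval (Function.update y v 0) q = boolVal b₀) (h₁ : eval (Function.update y v 1) q = boolVal b₁) :
    eval y (qop Q v q) = boolVal (if Q v then b₀ && b₁ else b₀ || b₁) := by
  unfold qop
  cases hQ : Q v
  · simpa using eval_exOp_boolean y v q h₀ h₁
  · simpa using eval_allOp_boolean y v q h₀ h₁

/-- **Boolean semantics of the protocol's polynomials**: if `P` arithmetizes `φ` (`P(x) = [φ x]` at Boolean
points) then `shenExpr Q pre rest P` evaluates at every Boolean point to the truth value of the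
quantified suffix. In particular the full expression is the constant `[Ψ ∈ TQBF]`.
[cite: AroraBarakCC2009, §8.3.3 (8.12) and Thm. 8.19] [cite: TrevisanVadhan2007, §4 (Lemma 4.1, "equals the truth value")] -/
theorem eval_shenExpr_boolPt (Q : σ → Bool) (P : MvPolynomial σ R) (φ : (σ → Bool) → Bool)
    (hP : ∀ x : σ → Bool, eval (boolPt x) P = boolVal (φ x)) :
    ∀ (rest pre : List σ) (x : σ → Bool),
      eval (boolPt x) (shenExpr Q pre rest P) = boolVal (qbfVal Q rest φ x)
  | [], _, x => hP x
  | v :: rest, pre, x => by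
    rw [shenExpr_cons]
    have h : ∀ b : Bool, eval (Function.update (boolPt x) v (boolVal b)) (linChain (pre ++ [v]) (shenExpr Q (pre ++ [v]) rest P)) =
        boolVal (qbfVal Q rest φ (Function.update x v b)) := fun b => by
      rw [← boolPt_update, eval_linChain_boolPt, eval_shenExpr_boolPt Q P φ hP rest (pre ++ [v])]
    have h₀ := h false
    have h₁ := h true
    rw [boolVal_false] at h₀
    rw [boolVal_true] at h₁
    rw [eval_qop_boolean Q v _ (boolPt x) h₀ h₁]
    rfl

end Shen

end Literature.Computability.Complexity

end
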